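import Literature.AlgebraicGeometry.Frobenioids.PerfectionSquareNotOneUnique
import HarnessLib

/-!
# Frobenioids I, Definition 3.1 (ii): the relations `Agree` and `Level.LE` of the perfection are
# DEFINITIONS — their universal closures are false (kernel witnesses at the degree model)

Proof-only companion (abc-iut cell, block F fact-proving wave, seat abc-iut-f-048; FACT-LIST rows
F-1207 `Perfection.Agree` and F-1209 `Perfection.Level.LE`, both `kernel_closedness = parametrised`)
to abc-iut-L1-d9's `Perfection.lean`.

Mochizuki, *The geometry of Frobenioids I: the general theory*, Kyushu J. Math. **62** (2008)
293–400, Definition 3.1 (ii) p. 56 [cite: MochizukiFrdI2008, Def. 3.1 (ii) p.56]: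
"`Hom^pf_C(A, B) := lim_→ Hom_C(A′, B′)`", the inductive limit over pairs of morphisms of Frobenius
type of the same Frobenius degree, with transition maps "`φ ↦ φ′`" (Prop. 1.10 (i)).

The two rows name the tree's RENDERING VOCABULARY of that inductive limit, not printed claims:
`Level.LE L L'` is the divisibility order `a ∣ a′ ∧ b ∣ b′` on levels (the index category of the
limit) and `Agree r s` is "the representatives `r`, `s` become equal after transport to a common
level" (the equivalence relation of a directed colimit of sets).  Per the cell's rule for
parametrised rows (plan R1, 2026-08-26): (ii) the universal closure of each is FALSE — proved here
by kernel witnesses in the degree-model Frobenioid `DegreeModel.C` of [FrdI] Thm. 5.2 (abc-iut-L1-d4's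
`DegreeModelFrobenioid.lean`; `DegreeModel.hF : IsFrobenioid DegreeModel.F` PROVED):
* `not_forall_level_le` — at the object `(ι 0, 1)` the level `(2, 2)` does not precede `(1, 1)`;
* `not_forall_agree` — at the same object, the two representatives at level `(1, 1)` given by the
  arrows of Frobenius degree `1` and `2` of `(ι 0)^{(1)} → (ι 0)^{(1)}` (both exist: degree-`0`
  objects admit endomorphisms of every Frobenius degree) never agree, since `deg_Fr` is an invariant
  of agreement (abc-iut-L1-d9's `degFr_sound`, Prop. 1.10 (i));
and the INSTANCE FORMS the cone consumes are the trunk's own PROVED lemmas `Agree.refl`,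
`Agree.symm`, `Agree.trans`, `instSetoidRep`, `Hom.mk_eq_mk`, `Level.le_rfl`, `Level.LE.trans`,
`Level.le_sup_left`, `Level.le_sup_right` (the `G:`/`I:` producers of the w5-d231 kernel census) —
re-exhibited below as closed existence statements (`exists_agree_and_not_agree`,
`exists_level_le_and_not_le`) so that both truth values of each relation are kernel-witnessed.
This file declares theorems only (no definition, no instance, no named fact).

Universe note: the universal closures are refuted at universe `0` (where the degree model lives);
a refutation at one universe is what "the schema is not a fact" means.  Nothing here concerns
[IUTchIII]; no side taken on Cor. 3.12; no statement of [FrdI] is asserted false — a definition has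
instances on both sides.
-/

namespace Literature.AlgebraicGeometry.Frobenioids

namespace PreFrobenioid.Perfection

open CategoryTheory

/-! ### The witnesses in the degree model -/

/-- The chosen Frobenius power `(ι 0)^{(1)}` of the degree-`0` object has degree `0`.
[cite: MochizukiFrdI2008, Thm. 5.2 (i) p.100] -/
private theorem dg_frobPow_ι_zero :
    DegreeModel.dg (frobPow DegreeModel.hF (DegreeModel.ι 0) 1) = 0 := by
  rw [DegreeModel.dg_frobPow, DegreeModel.dg_ι, mul_zero]

/-- Hence `(ι 0)^{(1)}` admits an endomorphism of every Frobenius degree `k` (`k · 0 ≤ 0`, the degree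
law of the model). [cite: MochizukiFrdI2008, Thm. 5.2 (i) p.100] -/
private theorem mul_dg_le (k : ℕ+) :
    (k : ℕ) * DegreeModel.dg (frobPow DegreeModel.hF (DegreeModel.ι 0) 1) ≤
      DegreeModel.dg (frobPow DegreeModel.hF (DegreeModel.ι 0) 1) := by
  rw [dg_frobPow_ι_zero, mul_zero]

/-- At the object `(ι 0, 1)` of the perfection and the level `(1, 1)`: if the representatives given
by the endomorphisms of Frobenius degree `k₁` and `k₂` agree then `k₁ = k₂` (Prop. 1.10 (i):
transport preserves `deg_Fr` — `degFr_sound`). [cite: MochizukiFrdI2008, Def. 3.1 (ii) p.56] -/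
private theorem eq_of_agree (k₁ k₂ : ℕ+)
    (h : Agree (X := (⟨DegreeModel.ι 0, 1⟩ : Perfection DegreeModel.hF)) (Y := ⟨DegreeModel.ι 0, 1⟩)
      ⟨⟨1, 1, rfl⟩, DegreeModel.homOf _ _ k₁ (mul_dg_le k₁)⟩
      ⟨⟨1, 1, rfl⟩, DegreeModel.homOf _ _ k₂ (mul_dg_le k₂)⟩) :
    k₁ = k₂ :=
  degFr_sound h

/-! ### F-1209 `Level.LE` -/

/-- **F-1209 (FACT-LIST) — `Level.LE` is a DEFINITION, its universal closure is false.**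
[FrdI] Def. 3.1 (ii) p. 56: the index order of the inductive limit `lim_→ Hom_C(A′, B′)`.  Witness:
in the perfection of the degree-model Frobenioid ([FrdI] Thm. 5.2), at the object `(ι 0, 1)`, the
level `(2, 2)` does not precede the level `(1, 1)` (`2 ∤ 1`).  The instance forms the cone consumes
(`Level.le_rfl`, `Level.LE.trans`, `Level.le_sup_left`, `Level.le_sup_right`) are PROVED in
`Perfection.lean`. [cite: MochizukiFrdI2008, Def. 3.1 (ii) p.56] -/
theorem not_forall_level_le :
    ¬ ∀ {D : Type} [Category.{0} D] {Φ : Dᵒᵖ ⥤ CommMonCat.{0}} {C : Type} [Category.{0} C]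
        {F : C ⥤ ElemFrobenioid Φ} {hF : IsFrobenioid F} {X Y : Perfection hF} (L L' : Level X Y),
        Literature.AlgebraicGeometry.Frobenioids.PreFrobenioid.Perfection.Level.LE L L' := by
  intro h
  have h21 : Level.LE (X := (⟨DegreeModel.ι 0, 1⟩ : Perfection DegreeModel.hF))
      (Y := ⟨DegreeModel.ι 0, 1⟩) ⟨2, 2, rfl⟩ ⟨1, 1, rfl⟩ := h _ _
  have h2 : ((2 : ℕ+) : ℕ) ∣ ((1 : ℕ+) : ℕ) := PNat.dvd_iff.mp h21.1
  exact absurd (Nat.le_of_dvd Nat.one_pos h2) (by decide)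

/-- **F-1209, both truth values kernel-witnessed** (closed): there are levels `L′ ≤ L` (and
`L′ ≤ L′ ⊔ L`, `Level.le_sup_left`) as well as levels with `¬ L ≤ L′` — `Level.LE` is a relation
with instances on both sides, not a fact. [cite: MochizukiFrdI2008, Def. 3.1 (ii) p.56] -/
theorem exists_level_le_and_not_le :
    ∃ (D : Type) (_ : Category.{0} D) (Φ : Dᵒᵖ ⥤ CommMonCat.{0}) (C : Type) (_ : Category.{0} C)
      (F : C ⥤ ElemFrobenioid Φ) (hF : IsFrobenioid F) (X Y : Perfection hF) (L L' : Level X Y),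
      Literature.AlgebraicGeometry.Frobenioids.PreFrobenioid.Perfection.Level.LE L' L ∧
        Literature.AlgebraicGeometry.Frobenioids.PreFrobenioid.Perfection.Level.LE L' (L'.sup L) ∧
        ¬ Literature.AlgebraicGeometry.Frobenioids.PreFrobenioid.Perfection.Level.LE L L' := by
  refine ⟨_, _, _, _, _, _, DegreeModel.hF, ⟨DegreeModel.ι 0, 1⟩, ⟨DegreeModel.ι 0, 1⟩, ⟨2, 2, rfl⟩,
    ⟨1, 1, rfl⟩, ⟨one_dvd _, one_dvd _⟩, Level.le_sup_left _ _, fun h21 => ?_⟩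
  have h2 : ((2 : ℕ+) : ℕ) ∣ ((1 : ℕ+) : ℕ) := PNat.dvd_iff.mp h21.1
  exact absurd (Nat.le_of_dvd Nat.one_pos h2) (by decide)

/-! ### F-1207 `Agree` -/

/-- **F-1207 (FACT-LIST) — `Agree` is a DEFINITION, its universal closure is false.**
[FrdI] Def. 3.1 (ii) p. 56: "`Hom^pf_C(A, B) := lim_→ Hom_C(A′, B′)`" — `Agree r s` is the
equivalence relation of this directed colimit (equal after transport to a common level).  Witness:
in the perfection of the degree-model Frobenioid ([FrdI] Thm. 5.2), at the object `(ι 0, 1)` and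
level `(1, 1)`, the representatives given by the endomorphisms of Frobenius degree `1` and `2` of
`(ι 0)^{(1)}` do not agree, because transport preserves `deg_Fr` (Prop. 1.10 (i); `degFr_sound`).
The instance forms the cone consumes (`Agree.refl`, `Agree.symm`, `Agree.trans`, `instSetoidRep`,
`Hom.mk_eq_mk`, `Hom.mk_lift`) are PROVED in `Perfection.lean`.
[cite: MochizukiFrdI2008, Def. 3.1 (ii) p.56] -/
theorem not_forall_agree :
    ¬ ∀ {D : Type} [Category.{0} D] {Φ : Dᵒᵖ ⥤ CommMonCat.{0}} {C : Type} [Category.{0} C]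
        {F : C ⥤ ElemFrobenioid Φ} {hF : IsFrobenioid F} {X Y : Perfection hF} (r s : Rep X Y),
        Literature.AlgebraicGeometry.Frobenioids.PreFrobenioid.Perfection.Agree r s :=
  fun h => absurd (eq_of_agree 1 2 (h _ _)) (by decide)

/-- **F-1207, both truth values kernel-witnessed** (closed): some representatives agree (every `r`
with itself and with its transports — `Agree.refl`, `Hom.mk_lift`) and some do not — `Agree` is a
relation with instances on both sides, not a fact. [cite: MochizukiFrdI2008, Def. 3.1 (ii) p.56] -/
theorem exists_agree_and_not_agree :
    ∃ (D : Type) (_ : Category.{0} D) (Φ : Dᵒᵖ ⥤ CommMonCat.{0}) (C : Type) (_ : Category.{0} C)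
      (F : C ⥤ ElemFrobenioid Φ) (hF : IsFrobenioid F) (X Y : Perfection hF) (r s : Rep X Y),
      Literature.AlgebraicGeometry.Frobenioids.PreFrobenioid.Perfection.Agree r r ∧
        ¬ Literature.AlgebraicGeometry.Frobenioids.PreFrobenioid.Perfection.Agree r s :=
  ⟨_, _, _, _, _, _, DegreeModel.hF, ⟨DegreeModel.ι 0, 1⟩, ⟨DegreeModel.ι 0, 1⟩,
    ⟨⟨1, 1, rfl⟩, DegreeModel.homOf _ _ 1 (mul_dg_le 1)⟩,
    ⟨⟨1, 1, rfl⟩, DegreeModel.homOf _ _ 2 (mul_dg_le 2)⟩, Agree.refl _,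
    fun h => absurd (eq_of_agree 1 2 h) (by decide)⟩

end PreFrobenioid.Perfection

end Literature.AlgebraicGeometry.Frobenioids
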